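import Summits.ValiantsHypothesis.ValiantsHypothesis.Theorems.LacunarySymmetroidMatrixDescartesLagrangeMirrorTower
import Summits.ValiantsHypothesis.ValiantsHypothesis.Theorems.LacunarySymmetroidMatrixDescartesFlagAsymptoticsPerturbed

/-!
# `MatrixDescartes` census — two-sided (mirror) Lagrange tower: the two flag letters at the test points

HONEST FRAMING.  Object-search cell `pub-symmetroid`, crux `Theses.LacunarySymmetroid.MatrixDescartes`
(stmt-ValiantsHypothesis-18050); seat val-sym-mdr-p1 (g2).  Part of the kernel port of the cell's TWO-SIDED Lagrange tower P4
(conjb-3 g4, ROUND4-MEMO §2) in the seat's arrowhead form (`…LagrangeMirrorDefs`): for EVERY `m ≥ 1` some real symmetric FOUR-term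
lacunary `m × m` pencil has `m² + 2m` distinct positive determinant roots (`¬ PosRootLawAt m 4 ((m+1)² − 2)`).  A LOWER-bound /
construction statement in census (CONJECTURE-A) currency for the `K = 4` column; it proves nothing about the crux `MatrixDescartes`
(an upper-bound statement at fat formats), nothing about the cubic-vs-quadratic fork beyond this floor, and nothing about `VP ≠ VNP`.
No definitions in this file.

THIS FILE. Down-window test points versus mirror roots and thresholds (`one_lt_ratioDn_iff`, `filter_onDn_eq`), vanishing of the opposite flag
letter (`tendsto_dn_at_up`, `tendsto_up_at_dn`), and the two FLAG-asymptotics applications: `eventually_sign_up` (native frame,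
`Flag.eventually_det_mul_pos_of_tendsto`) and `eventually_sign_dn` (mirror frame through `C⁻¹`; the `ε`-powers collect to `ε^m`). [folklore]
-/

-- `Summit.ValiantsHypothesis.ValiantsHypothesis.…` repeats a component by the D-0017 layout
-- (single-conjunct summit), which the `dupNamespace` linter flags; the name is mandated.
set_option linter.dupNamespace false

namespace Summit.ValiantsHypothesis.ValiantsHypothesis.Theorems.LacunarySymmetroidMatrixDescartes.Census.LagrangeTower

open Matrix Polynomial Finset
open scoped BigOperators

section AsmA

open Filter Topology

/-! ### Down-window test points versus mirror roots and thresholds -/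

/-- `spt w r < zwin w i ↔ r ≤ i`. -/
theorem spt_lt_zwin_iff (w r i : ℕ) : spt w r < zwin w i ↔ r ≤ i := by
  unfold spt zwin
  have hw : 0 < (w : ℝ) + 1 := by positivity
  have h4 := four_inv_pow_pos w
  rw [mul_lt_mul_iff_right₀ h4, add_lt_add_iff_left]
  rw [show (2 * (w : ℝ) + 2) = 2 * ((w : ℝ) + 1) by ring, div_lt_div_iff₀ (by positivity) hw]
  constructor
  · intro h
    by_contra hc
    push Not at hc
    have : (i : ℝ) + 1 ≤ r := by exact_mod_cast hc
    nlinarith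
  · intro h
    have : (r : ℝ) ≤ i := by exact_mod_cast h
    nlinarith

/-- `zwin w i < spt w r ↔ i < r`. -/
theorem zwin_lt_spt_iff (w r i : ℕ) : zwin w i < spt w r ↔ i < r := by
  unfold spt zwin
  have hw : 0 < (w : ℝ) + 1 := by positivity
  have h4 := four_inv_pow_pos w
  rw [mul_lt_mul_iff_right₀ h4, add_lt_add_iff_left]
  rw [show (2 * (w : ℝ) + 2) = 2 * ((w : ℝ) + 1) by ring, div_lt_div_iff₀ hw (by positivity)]
  constructor
  · intro h
    by_contra hc
    push Not at hc
    have : (r : ℝ) ≤ i := by exact_mod_cast hc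
    nlinarith
  · intro h
    have : (i : ℝ) + 1 ≤ r := by exact_mod_cast h
    nlinarith

/-- Test points of a mirror window are not mirror roots. -/
theorem spt_ne_mroot (m j r : ℕ) (i : Fin j) : spt (2 * m - j) r ≠ mroot m j i := by
  intro h
  unfold mroot at h
  rcases Nat.lt_or_ge (i : ℕ) r with hi | hi
  · have := (zwin_lt_spt_iff (2 * m - j) r i).mpr hi; rw [h] at this; exact lt_irrefl _ this
  · have := (spt_lt_zwin_iff (2 * m - j) r i).mpr hi; rw [h] at this; exact lt_irrefl _ this

/-- The mirror level-`j` determinant does not vanish at its test points (`j ≤ m`). -/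
theorem det_mlevel_spt_ne_zero (m j : ℕ) (hj : j ≤ m) (r : ℕ) :
    Matrix.det ((mtower m j).A + spt (2 * m - j) r • (mtower m j).B) ≠ 0 :=
  det_levelAt_ne_zero (mtower m j) (mtower_goodAt m j hj) _ fun i => spt_ne_mroot m j r i

/-- Downward signs are nonzero (`a + 1 ≤ m`). -/
theorem sgnDn_ne_zero (m a : ℕ) (ha : a + 1 ≤ m) : sgnDn m a ≠ 0 := by
  unfold sgnDn
  refine neg_ne_zero.mpr (mul_ne_zero (det_mlevel_spt_ne_zero m a (by omega) a) ?_)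
  have := det_mlevel_spt_ne_zero m (a + 1) ha 0
  rwa [show 2 * m - (a + 1) = 2 * m - a - 1 by omega] at this

/-- `levelSignDn m j ≠ 0`. -/
theorem levelSignDn_ne_zero (m j : ℕ) : levelSignDn m j ≠ 0 :=
  Finset.prod_ne_zero_iff.mpr fun a _ => sgnDn_ne_zero m a (by have := a.isLt; omega)

/-- Thresholds of the downward flag are positive. -/
theorem thrDn_pos (m a : ℕ) : 0 < thrDn m a := thr_pos _

/-- At an UP test point (window `j ≤ m`), every downward coordinate is far below: `thrDn a < spt j r`. -/
theorem thrDn_lt_spt_up {m j a : ℕ} (hj : j ≤ m) (ha : a < m) (r : ℕ) : thrDn m a < spt j r := by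
  unfold thrDn
  exact thr_lt_spt (by omega) r

/-- At a DOWN test point (mirror level `j < m`, window `2m − j`), every upward coordinate is far above: `spt (2m−j) r < thr a`. -/
theorem spt_dn_lt_thr {m j a r : ℕ} (hj : j < m) (ha : a < m) (hr : r ≤ j) : spt (2 * m - j) r < thr a :=
  spt_lt_thr (by omega) (by omega)

/-- Downward coordinate `a` is ON at the test points of mirror level `j` iff `j ≤ a` (`j < m`, `a < m`, `r ≤ j`). -/
theorem one_lt_ratioDn_iff {m j a r : ℕ} (hj : j < m) (ha : a < m) (hr : r ≤ j) :
    1 < thrDn m a / spt (2 * m - j) r ↔ j ≤ a := by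
  rw [one_lt_div (spt_pos _ _)]
  unfold thrDn
  constructor
  · intro h
    by_contra hc
    have : thr (2 * m - a - 1) < spt (2 * m - j) r := thr_lt_spt (by omega) r
    exact absurd h (not_lt.mpr this.le)
  · intro h
    exact spt_lt_thr (by omega) (by omega)

/-- No down test point sits on a downward threshold. -/
theorem ratioDn_ne_one {m j a r : ℕ} (hj : j < m) (ha : a < m) (hr : r ≤ j) : thrDn m a / spt (2 * m - j) r ≠ 1 := by
  intro h
  rw [div_eq_one_iff_eq (spt_pos _ _).ne'] at h
  unfold thrDn at h
  rcases Nat.lt_or_ge a j with hlt | hge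
  · have := thr_lt_spt (show 2 * m - j ≤ 2 * m - a - 1 by omega) r
    rw [h] at this; exact lt_irrefl _ this
  · have := spt_lt_thr (show 2 * m - a - 1 < 2 * m - j by omega) (show r ≤ 2 * m - j by omega)
    rw [h] at this; exact lt_irrefl _ this

/-- The ON set of the downward flag at the test points of mirror level `j`. -/
theorem filter_onDn_eq {m j r : ℕ} (hj : j < m) (hr : r ≤ j) :
    (univ.filter (fun a : Fin m => 1 < thrDn m a / spt (2 * m - j) r)) = univ.filter (fun a : Fin m => j ≤ (a : ℕ)) := by
  ext a
  simp only [Finset.mem_filter, Finset.mem_univ, true_and, one_lt_ratioDn_iff hj a.isLt hr]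

/-- The OFF set of the downward flag at the test points of mirror level `j`. -/
theorem mem_offDn_iff {m j r : ℕ} (hj : j < m) (hr : r ≤ j) (a : Fin m) :
    a ∈ (univ.filter (fun a : Fin m => 1 < thrDn m a / spt (2 * m - j) r))ᶜ ↔ (a : ℕ) < j := by
  rw [filter_onDn_eq hj hr, Finset.mem_compl, Finset.mem_filter]
  simp

/-! ### Vanishing of the opposite flag letter -/

/-- A conjugated diagonal letter with geometrically small entries tends to `0`. -/
theorem tendsto_conj_diagonal_zero {m : ℕ} (P : Matrix (Fin m) (Fin m) ℝ) (c : ℝ) (σ ρ : Fin m → ℝ)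
    (h0 : ∀ a, 0 ≤ ρ a) (h1 : ∀ a, ρ a < 1) (e : ℕ) :
    Tendsto (fun D : ℕ => Pᵀ * (c • diagonal fun a : Fin m => σ a * ρ a ^ (D + e)) * P) atTop (𝓝 0) := by
  have hv : Tendsto (fun D : ℕ => fun a : Fin m => σ a * ρ a ^ (D + e)) atTop (𝓝 0) := by
    refine tendsto_pi_nhds.mpr fun a => ?_
    have h := (tendsto_pow_atTop_nhds_zero_of_lt_one (h0 a) (h1 a)).comp (tendsto_add_atTop_nat e)
    have := h.const_mul (σ a)
    simpa using this
  have hcont : Continuous fun v : Fin m → ℝ => Pᵀ * (c • diagonal v) * P :=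
    ((continuous_const.matrix_mul ((continuous_id.matrix_diagonal).const_smul c)).matrix_mul continuous_const)
  have h := (hcont.tendsto 0).comp hv
  rw [show (c • diagonal (0 : Fin m → ℝ)) = 0 by simp, Matrix.mul_zero, Matrix.zero_mul] at h
  exact h

/-- At an UP test point `t = spt j r` (`j ≤ m`), the downward letter vanishes as `D → ∞`. -/
theorem tendsto_dn_at_up (m j r : ℕ) (hj : j ≤ m) :
    Tendsto (fun D : ℕ => (congC m)ᵀ * (congEps m • diagonal fun a : Fin m => sgnDn m a * (thrDn m a / spt j r) ^ D) *
      congC m) atTop (𝓝 0) := by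
  have := tendsto_conj_diagonal_zero (congC m) (congEps m) (fun a => sgnDn m a) (fun a => thrDn m a / spt j r)
    (fun a => (div_pos (thrDn_pos m a) (spt_pos j r)).le)
    (fun a => (div_lt_one (spt_pos j r)).mpr (thrDn_lt_spt_up hj a.isLt r)) 0
  simpa using this

/-- At a DOWN test point `t = spt (2m−j) r` (`j < m`, `r ≤ j`), the upward letter, seen in the mirror frame, vanishes as `D → ∞`. -/
theorem tendsto_up_at_dn (m j r : ℕ) (hj : j < m) (hr : r ≤ j) :
    Tendsto (fun D : ℕ => (congCinv m)ᵀ * ((1 : ℝ) • diagonal fun a : Fin m => sgn a * (spt (2 * m - j) r / thr a) ^ (D + 1)) *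
      congCinv m) atTop (𝓝 0) :=
  tendsto_conj_diagonal_zero (congCinv m) 1 (fun a => sgn a) (fun a => spt (2 * m - j) r / thr a)
    (fun a => (div_pos (spt_pos _ _) (thr_pos a)).le)
    (fun a => (div_lt_one (thr_pos a)).mpr (spt_dn_lt_thr hj a.isLt hr)) 1

/-! ### The normalised witness `Gmat` at the test points -/

/-- **Up points.**  At `t = spt j r`, `j ≤ m`, `r ≤ j`: for all large `D`, `det (Gmat m D t)` has the sign of `Ewalk`-type datum
`levelSign m j · det(level j at t)`. -/
theorem eventually_sign_up (m j r : ℕ) (hj : j ≤ m) (hr : r ≤ j) :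
    ∀ᶠ D : ℕ in atTop, 0 < Matrix.det (Gmat m D (spt j r)) *
      (levelSign m j * Matrix.det ((tower j).A + spt j r • (tower j).B)) := by
  set t := spt j r with ht
  -- the convergent base
  set M : ℕ → Matrix (Fin m) (Fin m) ℝ := fun D => (tower m).A + t • (tower m).B +
    (congC m)ᵀ * (congEps m • diagonal fun a : Fin m => sgnDn m a * (thrDn m a / t) ^ D) * congC m with hM
  have hMlim : Tendsto M atTop (𝓝 ((tower m).A + t • (tower m).B)) := by
    have := (tendsto_dn_at_up m j r hj).const_add ((tower m).A + t • (tower m).B)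
    simpa [hM] using this
  -- signs and ratios of the upward letter at exponent `D+1`: `σ_a = sgn a · (t/thr a)`, `r_a = t/thr a`
  have hσ : ∀ a : Fin m, sgn a * (t / thr a) ≠ 0 := fun a =>
    mul_ne_zero (sgn_ne_zero a) (div_pos (spt_pos j r) (thr_pos a)).ne'
  have hflag := Flag.eventually_det_mul_pos_of_tendsto M ((tower m).A + t • (tower m).B) hMlim
    (fun a : Fin m => sgn a * (t / thr a)) (fun a : Fin m => t / thr a) hσ (fun a => ratio_pos j r a)
    (fun a => ratio_ne_one hr a) ?_
  · -- identify the limiting datum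
    have hOFF := off_minor_eq (m := m) hj hr
    have hfilt := filter_on_eq (m := m) (j := j) hr
    have hpos : 0 < ∏ a ∈ univ.filter (fun a : Fin m => 1 < t / thr a), t / thr a :=
      Finset.prod_pos fun a _ => ratio_pos j r a
    filter_upwards [hflag] with D hD
    have hG : Gmat m D t = M D + diagonal (fun a : Fin m => sgn a * (t / thr a) * (t / thr a) ^ D) := by
      rw [hM]; unfold Gmat
      rw [add_right_comm]
      congr 2; funext a; ring
    rw [hG]
    rw [Finset.prod_mul_distrib, hOFF] at hD
    rw [hfilt] at hD hpos
    unfold levelSign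
    -- remove the positive factor `∏ (t/thr a)`
    have : Matrix.det (M D + diagonal fun a : Fin m => sgn ↑a * (t / thr ↑a) * (t / thr ↑a) ^ D) *
        ((∏ a ∈ univ.filter (fun a : Fin m => j ≤ (a : ℕ)), sgn (a : ℕ)) *
          (∏ a ∈ univ.filter (fun a : Fin m => j ≤ (a : ℕ)), t / thr a) *
          Matrix.det ((tower j).A + t • (tower j).B))
        = (Matrix.det (M D + diagonal fun a : Fin m => sgn ↑a * (t / thr ↑a) * (t / thr ↑a) ^ D) *
          ((∏ a ∈ univ.filter (fun a : Fin m => j ≤ (a : ℕ)), sgn (a : ℕ)) * Matrix.det ((tower j).A + t • (tower j).B))) *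
          ∏ a ∈ univ.filter (fun a : Fin m => j ≤ (a : ℕ)), t / thr a := by ring
    rw [this] at hD
    exact (pos_iff_pos_of_mul_pos hD).mpr hpos
  · rw [off_minor_eq (m := m) hj hr]
    exact det_level_spt_ne_zero j r

end AsmA

section AsmB

open Filter Topology

/-- The `OFF`-minor of the mirror top level at a test point of mirror level `j < m` is the mirror level-`j` determinant. -/
theorem offDn_minor_eq {m j r : ℕ} (hj : j < m) (hr : r ≤ j) (t : ℝ) :
    Matrix.det ((((mtower m m).A + t • (mtower m m).B)).submatrix
        ((↑) : ↥(univ.filter (fun a : Fin m => 1 < thrDn m a / spt (2 * m - j) r))ᶜ → Fin m)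
        ((↑) : ↥(univ.filter (fun a : Fin m => 1 < thrDn m a / spt (2 * m - j) r))ᶜ → Fin m))
      = Matrix.det ((mtower m j).A + t • (mtower m j).B) := by
  rw [det_submatrix_subtype_eq hj.le _ _ (mem_offDn_iff hj hr)]
  obtain ⟨hA, hB⟩ := mtower_leading m m j hj.le
  simp only [Matrix.submatrix_add, Matrix.submatrix_smul, Pi.add_apply, Pi.smul_apply, hA, hB]

/-- `ε^{#ON} · ε^{#OFF} = ε^m` for complementary coordinate sets. -/
theorem eps_pow_card_compl (m : ℕ) (S : Finset (Fin m)) (ε : ℝ) :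
    ε ^ S.card * ε ^ Fintype.card ↥(Sᶜ) = ε ^ m := by
  rw [Fintype.card_coe, Finset.card_compl, Fintype.card_fin, ← pow_add]
  congr 1
  have := S.card_le_univ
  rw [Fintype.card_fin] at this
  omega

/-- **Down points.**  At `t = spt (2m−j) r`, `j < m`, `r ≤ j`: for all large `D`, `det (Gmat m D t)` has the sign of
`ε^m · levelSignDn m j · det(mirror level j at t)`. -/
theorem eventually_sign_dn (m j r : ℕ) (hj : j < m) (hr : r ≤ j) :
    ∀ᶠ D : ℕ in atTop, 0 < Matrix.det (Gmat m D (spt (2 * m - j) r)) *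
      (congEps m ^ m * levelSignDn m j * Matrix.det ((mtower m j).A + spt (2 * m - j) r • (mtower m j).B)) := by
  set t := spt (2 * m - j) r with ht
  have htpos : 0 < t := spt_pos _ _
  set N₂ := (mtower m m).A + t • (mtower m m).B with hN₂
  set E : ℕ → Matrix (Fin m) (Fin m) ℝ := fun D =>
    (congCinv m)ᵀ * ((1 : ℝ) • diagonal fun a : Fin m => sgn a * (t / thr a) ^ (D + 1)) * congCinv m with hE
  set M : ℕ → Matrix (Fin m) (Fin m) ℝ := fun D => congEps m • N₂ + E D with hM
  have hMlim : Tendsto M atTop (𝓝 (congEps m • N₂)) := by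
    have := (tendsto_up_at_dn m j r hj hr).const_add (congEps m • N₂)
    simpa [hM, hE] using this
  have hσ : ∀ a : Fin m, congEps m * sgnDn m a ≠ 0 := fun a => by
    refine mul_ne_zero ?_ (sgnDn_ne_zero m a (by have := a.isLt; omega))
    rcases congEps_cases m with h | h <;> rw [h] <;> norm_num
  have hρ : ∀ a : Fin m, 0 < thrDn m a / t := fun a => div_pos (thrDn_pos m a) htpos
  have hflag := Flag.eventually_det_mul_pos_of_tendsto M (congEps m • N₂) hMlim
    (fun a : Fin m => congEps m * sgnDn m a) (fun a : Fin m => thrDn m a / t) hσ hρ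
    (fun a => ratioDn_ne_one hj a.isLt hr) ?_
  · -- the conjugated witness is `M_D + diagonal`
    have hX : ∀ D : ℕ, (congCinv m)ᵀ * Gmat m D t * congCinv m
        = M D + diagonal (fun a : Fin m => congEps m * sgnDn m a * (thrDn m a / t) ^ D) := by
      intro D
      rw [hM, hE]
      unfold Gmat
      have h1 := congCinv_conj m t
      have h2 : (congCinv m)ᵀ * ((congC m)ᵀ * (congEps m • diagonal fun a : Fin m => sgnDn m a * (thrDn m a / t) ^ D) *
          congC m) * congCinv m = diagonal (fun a : Fin m => congEps m * sgnDn m a * (thrDn m a / t) ^ D) := by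
        have hcc := congC_mul_congCinv m
        have hct : (congCinv m)ᵀ * (congC m)ᵀ = 1 := by rw [← Matrix.transpose_mul, hcc, Matrix.transpose_one]
        calc (congCinv m)ᵀ * ((congC m)ᵀ * (congEps m • diagonal fun a : Fin m => sgnDn m a * (thrDn m a / t) ^ D) *
              congC m) * congCinv m
            = ((congCinv m)ᵀ * (congC m)ᵀ) * (congEps m • diagonal fun a : Fin m => sgnDn m a * (thrDn m a / t) ^ D) *
              (congC m * congCinv m) := by simp only [Matrix.mul_assoc]
          _ = congEps m • diagonal (fun a : Fin m => sgnDn m a * (thrDn m a / t) ^ D) := by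
              rw [hct, hcc, Matrix.one_mul, Matrix.mul_one]
          _ = diagonal (fun a : Fin m => congEps m * sgnDn m a * (thrDn m a / t) ^ D) := by
              rw [← Matrix.diagonal_smul]; congr 1; funext a; simp only [Pi.smul_apply, smul_eq_mul]; ring
      simp only [one_smul]
      rw [Matrix.mul_add, Matrix.mul_add, Matrix.add_mul, Matrix.add_mul, h1, h2, hN₂]
    have hdet : ∀ D : ℕ, Matrix.det ((congCinv m)ᵀ * Gmat m D t * congCinv m) = (congCinv m).det ^ 2 * Matrix.det (Gmat m D t) := by
      intro D; rw [Matrix.det_mul, Matrix.det_mul, Matrix.det_transpose]; ring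
    -- identify the limiting datum
    have hOFF : Matrix.det ((congEps m • N₂).submatrix
        ((↑) : ↥(univ.filter (fun a : Fin m => 1 < thrDn m a / t))ᶜ → Fin m)
        ((↑) : ↥(univ.filter (fun a : Fin m => 1 < thrDn m a / t))ᶜ → Fin m))
        = congEps m ^ Fintype.card ↥(univ.filter (fun a : Fin m => 1 < thrDn m a / t))ᶜ *
          Matrix.det ((mtower m j).A + t • (mtower m j).B) := by
      rw [Matrix.submatrix_smul, Pi.smul_apply, Pi.smul_apply, Matrix.det_smul, hN₂, offDn_minor_eq hj hr]
    have hprod : ∏ a ∈ univ.filter (fun a : Fin m => 1 < thrDn m a / t), congEps m * sgnDn m a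
        = congEps m ^ (univ.filter (fun a : Fin m => 1 < thrDn m a / t)).card * levelSignDn m j := by
      rw [Finset.prod_mul_distrib, Finset.prod_const]
      unfold levelSignDn
      rw [filter_onDn_eq hj hr]
    have hCpos : 0 < (congCinv m).det ^ 2 := by have := det_congCinv_ne_zero m; positivity
    filter_upwards [hflag] with D hD
    rw [← hX D, hdet D, hOFF, hprod] at hD
    have : (congCinv m).det ^ 2 * Matrix.det (Gmat m D t) *
        (congEps m ^ (univ.filter (fun a : Fin m => 1 < thrDn m a / t)).card * levelSignDn m j *
          (congEps m ^ Fintype.card ↥(univ.filter (fun a : Fin m => 1 < thrDn m a / t))ᶜ *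
            Matrix.det ((mtower m j).A + t • (mtower m j).B)))
        = (Matrix.det (Gmat m D t) * ((congEps m ^ (univ.filter (fun a : Fin m => 1 < thrDn m a / t)).card *
            congEps m ^ Fintype.card ↥(univ.filter (fun a : Fin m => 1 < thrDn m a / t))ᶜ) * levelSignDn m j *
            Matrix.det ((mtower m j).A + t • (mtower m j).B))) * (congCinv m).det ^ 2 := by ring
    rw [this, eps_pow_card_compl] at hD
    exact (pos_iff_pos_of_mul_pos hD).mpr hCpos
  · -- the limiting minor is nonzero
    rw [Matrix.submatrix_smul, Pi.smul_apply, Pi.smul_apply, Matrix.det_smul, hN₂, offDn_minor_eq hj hr]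
    refine mul_ne_zero (pow_ne_zero _ ?_) (det_mlevel_spt_ne_zero m j hj.le r)
    rcases congEps_cases m with h | h <;> rw [h] <;> norm_num

end AsmB

end Summit.ValiantsHypothesis.ValiantsHypothesis.Theorems.LacunarySymmetroidMatrixDescartes.Census.LagrangeTower
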